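/-
  Summits/AtomisticToContinuum/Crystallization/Theorems/OverbindingBudgetAffineFarBallBarlowSharp.lean

  residual stmt-AtomisticToContinuum-31280 · slot Z `FarAggregatePricing 12 (1/25) (1/2000) (1/(2·10⁷))` · leaf LAB₁′
  `ShelteredShellLabelling' (1/25) (1/2000)` (leaf list v14′, critic rows 890/899/908; engine LAB₁′ ⟸ R_aff′ ∧ BBI₀ ∧ G-BBI ∧ CORE + E4):
  BBI♯ `BarlowBallIdentificationSharp` — G-BBI's BBI½ with the exhaustiveness radius `3/2` SHARPENED to Hales's `h₀ = 1.26` (the radius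
  the engine glue E4 can actually supply through a `2θ`-distorted global linear map), PROVED from BBI₀ by G-BBI's proof, and the pattern
  lemma «a kissing pattern is an isometric image of a Barlow contact shell».  decomp-a2c lens-4, generation 58 (E4 part 1).
  Imports the TREE files `…FarBallBarlowTransfer` (G-BBI) and `Literature…BarlowTexturedSet`.  0 sorry · 0 axiom · no instance · no notation · no option.
-/
import Summits.AtomisticToContinuum.Crystallization.Theorems.OverbindingBudgetAffineFarBallBarlowTransfer
import Literature.MathematicalPhysics.StatisticalMechanics.BarlowTexturedSet

/-! # BBI♯ — the ball identification at exhaustiveness radius `h₀` (PROVED from BBI₀), E4 part 1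

WHY (finding F-EXH, g58).  The engine glue E4 feeds BBI the point set `Λ = {B⁻¹(z k − z i)/a₀}` read off R_aff′'s straightened sites
`z` through the GLOBAL linear part `B`, `‖B − Q₀‖ ≤ 2θ + Cε₁ ≤ 0.081` (`θ = 1/25`).  Exact two-shell patterns survive `B⁻¹`, but R_aff′'s
exhaustiveness «every `z k' ≠ z k` within `(3/2)·a₀` is a pattern point» only yields, in `Λ`-coordinates, exhaustiveness within
`(3/2)/‖B‖ ≥ 1.38` — NOT within `3/2` as BBI½ (`BarlowBallIdentificationHalf`) asks.  G-BBI's proof, however, uses exhaustiveness only to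
put every distance in `{1, √2} ∪ [h₀, ∞)` (`h₀ = 1.26`, BBI₀'s gap); so the hypothesis is sharpened to radius `h₀`:

* BBI♯ `BarlowBallIdentificationSharp` [NEW · the form E4 consumes]: BBI½ VERBATIM with `dist x' x ≤ 3/2 →` replaced by `dist x' x < h₀ →`
  in the exhaustiveness clause.  `BBI♯ → BBI½` (`barlowBallIdentificationHalf_of_sharp`, PROVED: a weaker hypothesis) and
  ★ `BBI₀ → BBI♯` (`barlowBallIdentificationSharp_of_ballBarlowFact`, PROVED: G-BBI's §3–§4 verbatim at radius `h₀`, `ρ₀ = 4`).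
* §3 «KISSING PATTERNS ARE CONTACT SHELLS» (`exists_kissing_eq_image_barlowShell`, PROVED): the unit vectors of an fcc/hcp two-shell
  pattern are `V '' barlowShell σ τ` for a linear isometry `V` and signs `σ, τ = ±1` (Literature `isArrangedIn_layerShell_fcc'/hcp'`,
  HalesDSP2012 §1.3) — the bridge between R_aff′/BBI's pattern language and the stacking's contact shells used by the lattice filling
  (E4 part 2) and the first-shell fits (E4 part 4, PCR₁ `barlowShell_relabelling_rigidity`).
HIDDEN-GAUGE / DEGENERATE AUDIT: as G-BBI (BBI₀ used once at `(2•(Λ ∩ B̄ρ), 0, ρ)`; `h₀ < √2` keeps the second shell out of the kissing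
shell; `1 < h₀` keeps the packing); §3 quantifies over both patterns and all four sign pairs arise (`(σ, −σ)` fcc, `(σ, σ)` hcp).
-/

namespace Summit.AtomisticToContinuum.Crystallization.Theorems.OverbindingBudgetAffineFarSmoothSplit

open Literature.MathematicalPhysics.StatisticalMechanics
open Literature.Geometry.DiscreteGeometry

/-! ## §1  The statement BBI♯ -/

/-- **BBI♯ · `BarlowBallIdentificationSharp`** (engine input E2, sharp form): a point set `Λ ∋ 0` in which every point of norm `≤ ρ`
carries an exact isometric fcc/hcp two-shell pattern, exhaustive within Hales's `h₀ = 1.26`, is, on the ball of radius `(ρ − ρ₀)/2`,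
contained in a based LINEAR-isometric image of a Barlow stacking with a Hägg word.  PROVED from BBI₀ (`ρ₀ = 4`). [this file] -/
def BarlowBallIdentificationSharp : Prop :=
  ∃ ρ₀ : ℝ, 0 ≤ ρ₀ ∧ ∀ (Λ : Set (EuclideanSpace ℝ (Fin 3))) (ρ : ℝ), ρ₀ ≤ ρ → (0 : EuclideanSpace ℝ (Fin 3)) ∈ Λ →
    (∀ x ∈ Λ, ‖x‖ ≤ ρ →
      ∃ (A : EuclideanSpace ℝ (Fin 3) →ₗᵢ[ℝ] EuclideanSpace ℝ (Fin 3)) (P : Finset (EuclideanSpace ℝ (Fin 3))),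
        (P = fccTwoShellPattern ∨ P = hcpTwoShellPattern) ∧ (∀ v ∈ P, x + A v ∈ Λ) ∧
        ∀ x' ∈ Λ, x' ≠ x → dist x' x < hales_h0 → ∃ v ∈ P, x' = x + A v) →
    ∃ (s : ℤ → ℤ) (g : EuclideanSpace ℝ (Fin 3) ≃ₗᵢ[ℝ] EuclideanSpace ℝ (Fin 3)) (p₀ : EuclideanSpace ℝ (Fin 3)),
      IsHaggSeq s ∧ p₀ ∈ barlowStacking 1 (Real.sqrt (2 / 3)) s ∧
      ∀ x ∈ Λ, ‖x‖ ≤ (ρ - ρ₀) / 2 → ∃ p ∈ barlowStacking 1 (Real.sqrt (2 / 3)) s, x = g (p - p₀)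

/-- **BBI♯ ⇒ BBI½** (PROVED: exhaustiveness within `3/2` implies exhaustiveness within `h₀ = 1.26 < 3/2`). [this file] -/
theorem barlowBallIdentificationHalf_of_sharp (h : BarlowBallIdentificationSharp) : BarlowBallIdentificationHalf := by
  obtain ⟨ρ₀, hρ₀, H⟩ := h
  refine ⟨ρ₀, hρ₀, fun Λ ρ hρ h0 hshell => H Λ ρ hρ h0 fun x hx hxρ => ?_⟩
  obtain ⟨A, P, hP, hmem, hexh⟩ := hshell x hx hxρ
  refine ⟨A, P, hP, hmem, fun x' hx' hne hd => hexh x' hx' hne ?_⟩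
  rw [hales_h0_eq] at hd
  linarith

/-! ## §2  ★ BBI₀ ⇒ BBI♯ (G-BBI's proof at radius `h₀`) -/

/-- Distance trichotomy from an `h₀`-exhaustive exact two-shell pattern: `1`, `√2`, or `≥ h₀`. [this file] -/
theorem dist_cases_of_twoShell_sharp {Λ : Set (EuclideanSpace ℝ (Fin 3))} {x x' : EuclideanSpace ℝ (Fin 3)}
    {A : EuclideanSpace ℝ (Fin 3) →ₗᵢ[ℝ] EuclideanSpace ℝ (Fin 3)} {P : Finset (EuclideanSpace ℝ (Fin 3))}
    (hP : P = fccTwoShellPattern ∨ P = hcpTwoShellPattern)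
    (hexh : ∀ x' ∈ Λ, x' ≠ x → dist x' x < hales_h0 → ∃ v ∈ P, x' = x + A v)
    (hx' : x' ∈ Λ) (hne : x' ≠ x) :
    dist x' x = 1 ∨ dist x' x = Real.sqrt 2 ∨ hales_h0 ≤ dist x' x := by
  by_cases hd : dist x' x < hales_h0
  · obtain ⟨v, hv, rfl⟩ := hexh x' hx' hne hd
    rw [dist_eq_norm, add_sub_cancel_left, A.norm_map]
    have hnorm : ‖v‖ = 1 ∨ ‖v‖ = Real.sqrt 2 := by
      rcases hP with rfl | rfl
      exacts [norm_of_mem_fccTwoShellPattern hv, norm_of_mem_hcpTwoShellPattern hv]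
    rcases hnorm with h | h
    · exact Or.inl h
    · exact Or.inr (Or.inl h)
  · exact Or.inr (Or.inr (not_lt.1 hd))

/-- In particular distinct points are at distance `≥ 1`. [this file] -/
theorem one_le_dist_of_twoShell_sharp {Λ : Set (EuclideanSpace ℝ (Fin 3))} {x x' : EuclideanSpace ℝ (Fin 3)}
    {A : EuclideanSpace ℝ (Fin 3) →ₗᵢ[ℝ] EuclideanSpace ℝ (Fin 3)} {P : Finset (EuclideanSpace ℝ (Fin 3))}
    (hP : P = fccTwoShellPattern ∨ P = hcpTwoShellPattern)
    (hexh : ∀ x' ∈ Λ, x' ≠ x → dist x' x < hales_h0 → ∃ v ∈ P, x' = x + A v)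
    (hx' : x' ∈ Λ) (hne : x' ≠ x) : 1 ≤ dist x' x := by
  rcases dist_cases_of_twoShell_sharp hP hexh hx' hne with h | h | h
  · rw [h]
  · rw [h]
    exact Real.one_le_sqrt.mpr (by norm_num)
  · rw [hales_h0_eq] at h
    linarith

section DoubledSharp

variable {Λ : Set (EuclideanSpace ℝ (Fin 3))} {ρ : ℝ}
  (hshell : ∀ x ∈ Λ, ‖x‖ ≤ ρ →
    ∃ (A : EuclideanSpace ℝ (Fin 3) →ₗᵢ[ℝ] EuclideanSpace ℝ (Fin 3)) (P : Finset (EuclideanSpace ℝ (Fin 3))),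
      (P = fccTwoShellPattern ∨ P = hcpTwoShellPattern) ∧ (∀ v ∈ P, x + A v ∈ Λ) ∧
      ∀ x' ∈ Λ, x' ≠ x → dist x' x < hales_h0 → ∃ v ∈ P, x' = x + A v)
include hshell

/-- The doubled ball is a packing of unit balls (sharp hypothesis). [this file] -/
theorem isUnitBallPacking_doubledBall_sharp : IsUnitBallPacking (doubledBall Λ ρ) := by
  intro z hz z' hz' hd
  obtain ⟨x, ⟨hxΛ, hxρ⟩, rfl⟩ := mem_doubledBall_iff.1 hz
  obtain ⟨y, ⟨hyΛ, -⟩, rfl⟩ := mem_doubledBall_iff.1 hz'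
  by_contra hne
  have hne' : y ≠ x := fun h => hne (by rw [h])
  obtain ⟨A, P, hP, -, hexh⟩ := hshell x hxΛ hxρ
  have h1 : 1 ≤ dist y x := one_le_dist_of_twoShell_sharp hP hexh hyΛ hne'
  rw [dist_smul₀, Real.norm_two, dist_comm] at hd
  linarith

/-- The doubled ball has Hales's `2h₀` gap (sharp hypothesis). [this file] -/
theorem gap_doubledBall_sharp :
    ∀ z ∈ doubledBall Λ ρ, ∀ z' ∈ doubledBall Λ ρ, z = z' ∨ dist z z' = 2 ∨ 2 * hales_h0 ≤ dist z z' := by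
  intro z hz z' hz'
  obtain ⟨x, ⟨hxΛ, hxρ⟩, rfl⟩ := mem_doubledBall_iff.1 hz
  obtain ⟨y, ⟨hyΛ, -⟩, rfl⟩ := mem_doubledBall_iff.1 hz'
  by_cases hxy : y = x
  · exact Or.inl (by rw [hxy])
  right
  obtain ⟨A, P, hP, -, hexh⟩ := hshell x hxΛ hxρ
  rw [dist_smul₀, Real.norm_two, dist_comm]
  rcases dist_cases_of_twoShell_sharp hP hexh hyΛ hxy with h | h | h
  · left
    rw [h, mul_one]
  · right
    rw [h]
    exact two_mul_hales_h0_le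
  · right
    linarith

omit hshell in
/-- The kissing shells of the doubled ball (sharp hypothesis): for `‖x‖ + 1 ≤ ρ`, the kissing shell of `2x` is `2A(P ∩ S²(1))`. [this file] -/
theorem kissingShell_doubledBall_eq_sharp {x : EuclideanSpace ℝ (Fin 3)} (A : EuclideanSpace ℝ (Fin 3) →ₗᵢ[ℝ] EuclideanSpace ℝ (Fin 3))
    {P K : Finset (EuclideanSpace ℝ (Fin 3))} (hK : ∀ y, y ∈ P ∧ ‖y‖ = 1 ↔ y ∈ K)
    (hmem : ∀ v ∈ P, x + A v ∈ Λ) (hexh : ∀ x' ∈ Λ, x' ≠ x → dist x' x < hales_h0 → ∃ v ∈ P, x' = x + A v)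
    (hx : ‖x‖ + 1 ≤ ρ) :
    kissingShell (doubledBall Λ ρ) ((2 : ℝ) • x) = (fun p => (2 : ℝ) • A p) '' (K : Set (EuclideanSpace ℝ (Fin 3))) := by
  ext z
  rw [mem_kissingShell_iff]
  constructor
  · rintro ⟨hzV, hz⟩
    obtain ⟨y, ⟨hyΛ, -⟩, hy⟩ := mem_doubledBall_iff.1 hzV
    have hz' : z = (2 : ℝ) • (y - x) := by rw [smul_sub, hy, add_sub_cancel_left]
    have hyx : ‖y - x‖ = 1 := by
      have h2 := hz
      rw [hz', norm_smul, Real.norm_two] at h2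
      linarith
    have hne : y ≠ x := by
      intro h
      rw [h, sub_self, norm_zero] at hyx
      exact zero_ne_one hyx
    obtain ⟨v, hv, hyv⟩ := hexh y hyΛ hne (by rw [dist_eq_norm, hyx, hales_h0_eq]; norm_num)
    have hAv : y - x = A v := by rw [hyv, add_sub_cancel_left]
    have hv1 : ‖v‖ = 1 := by rw [← A.norm_map, ← hAv, hyx]
    refine ⟨v, (hK v).1 ⟨hv, hv1⟩, ?_⟩
    show (2 : ℝ) • A v = z
    rw [hz', hAv]
  · rintro ⟨v, hvK, rfl⟩
    obtain ⟨hvP, hv1⟩ := (hK v).2 hvK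
    refine ⟨mem_doubledBall_iff.2 ⟨x + A v, ⟨hmem v hvP, ?_⟩, by rw [smul_add]⟩, ?_⟩
    · calc ‖x + A v‖ ≤ ‖x‖ + ‖A v‖ := norm_add_le _ _
        _ = ‖x‖ + 1 := by rw [A.norm_map, hv1]
        _ ≤ ρ := hx
    · show ‖(2 : ℝ) • A v‖ = 2
      rw [norm_smul, Real.norm_two, A.norm_map, hv1, mul_one]

/-- The kissing shells of the doubled ball deep inside are fcc/hcp kissing patterns (sharp hypothesis). [this file] -/
theorem isArrangedIn_kissingShell_doubledBall_sharp {z : EuclideanSpace ℝ (Fin 3)} (hz : z ∈ doubledBall Λ ρ)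
    (hd : dist 0 z < 2 * ρ - 2) :
    IsArrangedIn (kissingShell (doubledBall Λ ρ) z) fccKissingPattern ∨
      IsArrangedIn (kissingShell (doubledBall Λ ρ) z) hcpKissingPattern := by
  obtain ⟨x, ⟨hxΛ, hxρ⟩, rfl⟩ := mem_doubledBall_iff.1 hz
  have hx : ‖x‖ + 1 ≤ ρ := by
    rw [dist_comm, dist_zero_right, norm_smul, Real.norm_two] at hd
    linarith
  obtain ⟨A, P, hP, hmem, hexh⟩ := hshell x hxΛ hxρ
  rcases hP with rfl | rfl
  · exact Or.inl ⟨A, kissingShell_doubledBall_eq_sharp A mem_fccTwoShellPattern_and_norm_eq_one_iff hmem hexh hx⟩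
  · exact Or.inr ⟨A, kissingShell_doubledBall_eq_sharp A mem_hcpTwoShellPattern_and_norm_eq_one_iff hmem hexh hx⟩

end DoubledSharp

/-- ★ **BBI₀ ⇒ BBI♯ with `ρ₀ = 4`** (G-BBI's Mazur–Ulam/base-point/halving argument, verbatim). [this file] -/
theorem barlowBallIdentificationSharp_of_ballBarlowFact (hBB : BallBarlowFact) : BarlowBallIdentificationSharp := by
  refine ⟨4, by norm_num, ?_⟩
  intro Λ ρ hρ h0 hshell
  have hpack := isUnitBallPacking_doubledBall_sharp hshell
  have hgap := gap_doubledBall_sharp hshell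
  have hpat : ∀ v ∈ doubledBall Λ ρ, dist 0 v < 2 * ρ - 2 →
      IsArrangedIn (kissingShell (doubledBall Λ ρ) v) fccKissingPattern ∨
        IsArrangedIn (kissingShell (doubledBall Λ ρ) v) hcpKissingPattern :=
    fun v hv hd => isArrangedIn_kissingShell_doubledBall_sharp hshell hv hd
  obtain ⟨s, hs, g, hg⟩ := hBB (doubledBall Λ ρ) hpack hgap 0 ρ hρ hpat
  have h0V : (0 : EuclideanSpace ℝ (Fin 3)) ∈ doubledBall Λ ρ := by
    have h := two_smul_mem_doubledBall h0 (show ‖(0 : EuclideanSpace ℝ (Fin 3))‖ ≤ ρ by rw [norm_zero]; linarith)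
    rwa [smul_zero] at h
  obtain ⟨q₀, hq₀, hgq₀⟩ := hg 0 h0V (by rw [dist_self]; linarith)
  refine ⟨s, g.toRealAffineIsometryEquiv.linearIsometryEquiv, (1 / 2 : ℝ) • q₀, hs, half_smul_mem_barlowStacking hq₀, ?_⟩
  intro x hxΛ hxn
  have hxρ : ‖x‖ ≤ ρ := by linarith [norm_nonneg x]
  have hd : dist (0 : EuclideanSpace ℝ (Fin 3)) ((2 : ℝ) • x) ≤ ρ := by
    rw [dist_comm, dist_zero_right, norm_smul, Real.norm_two]
    linarith
  obtain ⟨q, hq, hgq⟩ := hg _ (two_smul_mem_doubledBall hxΛ hxρ) hd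
  refine ⟨(1 / 2 : ℝ) • q, half_smul_mem_barlowStacking hq, ?_⟩
  have key : g.toRealAffineIsometryEquiv.linearIsometryEquiv (q - q₀) = (2 : ℝ) • x := by
    have h := g.toRealAffineIsometryEquiv.map_vsub q q₀
    rw [vsub_eq_sub, vsub_eq_sub] at h
    rw [h]
    show g q - g q₀ = (2 : ℝ) • x
    rw [hgq, hgq₀, sub_zero]
  calc x = (1 / 2 : ℝ) • ((2 : ℝ) • x) := by rw [smul_smul]; norm_num
    _ = (1 / 2 : ℝ) • g.toRealAffineIsometryEquiv.linearIsometryEquiv (q - q₀) := by rw [key]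
    _ = g.toRealAffineIsometryEquiv.linearIsometryEquiv ((1 / 2 : ℝ) • q - (1 / 2 : ℝ) • q₀) := by
        rw [← smul_sub, LinearIsometryEquiv.map_smul]

/-- BBI₀ ⇒ BBI♯ ⇒ BBI½: G-BBI factors through the sharp form. [this file] -/
theorem ballBarlowTransfer_of_sharp : BallBarlowTransfer :=
  fun h => barlowBallIdentificationHalf_of_sharp (barlowBallIdentificationSharp_of_ballBarlowFact h)

/-! ## §3  Kissing patterns are isometric images of Barlow contact shells -/

/-- **The unit vectors of an fcc/hcp two-shell pattern form an isometric image of a Barlow contact shell** `barlowShell σ τ`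
(`σ, τ = ±1`; fcc: `(1, −1)`, hcp: `(1, 1)`). [HalesDSP2012 §1.3; Literature `isArrangedIn_layerShell_fcc'/hcp'`] -/
theorem exists_kissing_eq_image_barlowShell {P : Finset (EuclideanSpace ℝ (Fin 3))}
    (hP : P = fccTwoShellPattern ∨ P = hcpTwoShellPattern) :
    ∃ (σ τ : ℝ), (σ = 1 ∨ σ = -1) ∧ (τ = 1 ∨ τ = -1) ∧
      ∃ V : EuclideanSpace ℝ (Fin 3) →ₗᵢ[ℝ] EuclideanSpace ℝ (Fin 3),
        ∀ v : EuclideanSpace ℝ (Fin 3), (v ∈ P ∧ ‖v‖ = 1) ↔ v ∈ V '' barlowShell σ τ := by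
  -- common step: from `layerShell σ τ = (2 • A ·) '' K` and `K = {v ∈ P | ‖v‖ = 1}`
  have step : ∀ (σ τ : ℝ) (K : Finset (EuclideanSpace ℝ (Fin 3))), (∀ y, y ∈ P ∧ ‖y‖ = 1 ↔ y ∈ K) →
      IsArrangedIn (layerShell σ τ) K →
      ∃ V : EuclideanSpace ℝ (Fin 3) →ₗᵢ[ℝ] EuclideanSpace ℝ (Fin 3),
        ∀ v : EuclideanSpace ℝ (Fin 3), (v ∈ P ∧ ‖v‖ = 1) ↔ v ∈ V '' barlowShell σ τ := by
    intro σ τ K hK hA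
    obtain ⟨A, hAK⟩ := hA
    set Ae := A.toLinearIsometryEquiv rfl with hAe
    have hAe_app : ∀ v, Ae v = A v := fun v => rfl
    refine ⟨Ae.symm.toLinearIsometry, fun v => ?_⟩
    rw [hK]
    constructor
    · intro hv
      refine ⟨A v, ?_, ?_⟩
      · rw [mem_barlowShell_iff, hAK]
        exact ⟨v, hv, rfl⟩
      · show Ae.symm (A v) = v
        rw [← hAe_app, Ae.symm_apply_apply]
    · rintro ⟨w, hw, rfl⟩
      rw [mem_barlowShell_iff, hAK] at hw
      obtain ⟨v, hv, hvw⟩ := hw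
      have h2 : A v = w := by
        have := congrArg (fun u => (2 : ℝ)⁻¹ • u) hvw
        simpa [smul_smul] using this
      have : Ae.symm.toLinearIsometry w = v := by
        show Ae.symm w = v
        rw [← h2, ← hAe_app, Ae.symm_apply_apply]
      rw [this]
      exact hv
  rcases hP with rfl | rfl
  · obtain ⟨V, hV⟩ := step 1 (-1) fccKissingPattern mem_fccTwoShellPattern_and_norm_eq_one_iff
      (isArrangedIn_layerShell_fcc' (σ := 1) (Or.inl rfl))
    exact ⟨1, -1, Or.inl rfl, Or.inr rfl, V, hV⟩
  · obtain ⟨V, hV⟩ := step 1 1 hcpKissingPattern mem_hcpTwoShellPattern_and_norm_eq_one_iff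
      (isArrangedIn_layerShell_hcp' (σ := 1) (Or.inl rfl))
    exact ⟨1, 1, Or.inl rfl, Or.inl rfl, V, hV⟩

/-- The unit vectors of an fcc/hcp two-shell pattern number twelve (as a set). [this file] -/
theorem ncard_kissing_eq_twelve {P : Finset (EuclideanSpace ℝ (Fin 3))}
    (hP : P = fccTwoShellPattern ∨ P = hcpTwoShellPattern) :
    {v : EuclideanSpace ℝ (Fin 3) | v ∈ P ∧ ‖v‖ = 1}.ncard = 12 ∧ {v : EuclideanSpace ℝ (Fin 3) | v ∈ P ∧ ‖v‖ = 1}.Finite := by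
  obtain ⟨σ, τ, hσ, hτ, V, hV⟩ := exists_kissing_eq_image_barlowShell hP
  have hset : {v : EuclideanSpace ℝ (Fin 3) | v ∈ P ∧ ‖v‖ = 1} = V '' barlowShell σ τ := Set.ext fun v => hV v
  rw [hset, Set.ncard_image_of_injective _ V.injective, ncard_barlowShell hσ hτ]
  exact ⟨rfl, (finite_barlowShell σ τ).image _⟩

end Summit.AtomisticToContinuum.Crystallization.Theorems.OverbindingBudgetAffineFarSmoothSplit
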